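import Summits.QuantumFields.QCD.Theorems.PauliWegnerSeaChiralOneScaleTrajectoryStubChiralityTransfer
import Literature.MathematicalPhysics.QuantumFieldTheory.QCDPhaseQuenchedMomentUpgrade

/-!
# Jensen bridge for line `Sketch` of crux `PauliWegnerSea.ChiralOneScaleTrajectory` (stmt-QuantumFields-17512)

`unsignedPin_two_of_fmPin` (card one-volume-goldstone-witness, kernel B2 "Jensen / power means"): at
`N_f = 2` and a degenerate bare-mass tuple, a frequently-violated decay certificate for the crux's OWN
`|det|`-weighted FRACTIONAL moment `E₊[X^s]` of the propagator entry sum `X = Σ_{a,i,b,j} |G_f((0,a,i),(ne₀,b,j))|`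
(`0 < s ≤ 2`; the currency of clauses (one-scale)/(iii)) at every rate is one for the `|det|`-weighted
SECOND moment `E₊[Σ |G_f|²]` (the unsigned pin of `signedPin_of_unsignedPin_two`) at every rate:
`E₊[Σ|G|²] ≥ E₊[X²]/144 ≥ (E₊[X^s])^{2/s}/144` (Cauchy–Schwarz over the `144` colour–spin pairs and
Jensen for the convex power `u ↦ u^{2/s}` under the phase-quenched probability measure), and a violation
`C' e^{-ε' a_k n} < E₊[X^s]` at rate `ε' = sε/2` with `C' = (144 max(C,1))^{s/2}` is the violation
`C e^{-ε a_k n} < E₊[Σ|G|²]`.  The finiteness of the second moment is where `N_f = 2` (a degenerate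
partner) enters: `|det D|·|G_f|² = |adj D_t|²` is bounded on the compact configuration space.

With `frequently_violation_of_eventual_lowerPin` (clause-(iii)-shaped eventual lower pins at rate `C₁`
give such certificates at every `ε' > C₁`), `signedPin_of_unsignedPin_two` and `chiralityTransfer_ae`
this closes the chain: at `N_f = 2` the chirality conjunct of the crux follows from the package's own
clause (iii) at degenerate tuples `(m,m)` as soon as its rate constants satisfy `inf_m C₁(m)/s(m) = 0`.
Sources: folklore (Jensen: Mathlib `ConvexOn.map_integral_le` through the tree's
`qcdPhaseQuenchedExpect_rpow_le_rpow`).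
-/

noncomputable section

namespace Summit.QuantumFields.QCD.Cruxes.ChiralOneScaleTrajectory.GoldstoneWitness

open scoped BigOperators
open MeasureTheory Filter
open Literature.MathematicalPhysics.QuantumFieldTheory Literature.MathematicalPhysics.QuantumLattice
  Literature.Probability.LatticeModels

variable {L : ℕ} [NeZero L]

/-- **Two degenerate flavours: the weighted squared propagator entry is an adjugate entry squared.**
`|det D| · |D⁻¹((f,X),(f,Y))|² ≤ |adj D_t(X,Y)|²` for `D = diracMatrix U (t,t)` (equality off
`{det D_t = 0}`, where the left side vanishes). [folklore] -/
theorem norm_det_mul_normSq_inv_le_two (U : GaugeConfig 4 L SU3) (t : ℝ) (f : Fin 2)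
    (X Y : TorusSite 4 L × Fin 3 × Fin 4) :
    ‖(diracMatrix U fun _ : Fin 2 => t).det‖ *
        ‖(diracMatrix U fun _ : Fin 2 => t)⁻¹ (quarkEquiv (f, X)) (quarkEquiv (f, Y))‖ ^ 2 ≤
      ‖(wilsonDirac (fundamentalRep (Fin 3)) U t 1).adjugate X Y‖ ^ 2 := by
  by_cases h : (wilsonDirac (fundamentalRep (Fin 3)) U t 1).det = 0
  · rw [det_diracMatrix_const, h, zero_pow two_ne_zero, norm_zero, zero_mul]
    positivity
  · have hre := det_wilsonDirac_eq_ofReal_re U t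
    have hd0 : (wilsonDirac (fundamentalRep (Fin 3)) U t 1).det.re ≠ 0 := fun h0 =>
      h (by rw [hre, h0, Complex.ofReal_zero])
    have hn : ‖(wilsonDirac (fundamentalRep (Fin 3)) U t 1).det‖ =
        |(wilsonDirac (fundamentalRep (Fin 3)) U t 1).det.re| := by
      conv_lhs => rw [hre]
      rw [Complex.norm_real, Real.norm_eq_abs]
    have hnorm : ‖(diracMatrix U fun _ : Fin 2 => t).det‖ =
        ((wilsonDirac (fundamentalRep (Fin 3)) U t 1).det.re) ^ 2 := by
      rw [det_diracMatrix_const, norm_pow, hn, sq_abs]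
    rw [norm_inv_diracMatrix_const_sq U t h f X Y, hnorm, ← mul_assoc,
      mul_inv_cancel₀ (pow_ne_zero 2 hd0), one_mul]

/-- **Phase-quenched integrability from a weight bound**: a measurable real observable `φ` with
`|det D| · |φ| ≤ C` everywhere is integrable under the phase-quenched probability measure
`qcdLatticeMeasure` (any `N_f`, masses, coupling). [folklore] -/
theorem integrable_qcdLatticeMeasure_of_weight_bound {Nf : ℕ} (β : ℝ) (mq : Fin Nf → ℝ)
    (φ : GaugeConfig 4 L SU3 → ℝ) (hφ : Measurable φ) (C : ℝ)
    (hC : ∀ U, ‖(diracMatrix U mq).det‖ * ‖φ U‖ ≤ C) :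
    Integrable φ (qcdLatticeMeasure L β mq) := by
  obtain ⟨hZ0, hZT⟩ := partitionFunction_fundamental_ne_zero_and_ne_top (S := L) β
  haveI : IsFiniteMeasure (wilsonWeight (d := 4) (L := L) (fundamentalRep (Fin 3)) β) :=
    ⟨by simpa [partitionFunction] using hZT.lt_top⟩
  have hdens : Measurable fun U : GaugeConfig 4 L SU3 =>
      ENNReal.ofReal (∏ f, ‖fermionDet (wilsonDirac (fundamentalRep (Fin 3)) U (mq f) 1)‖) := by
    have := measurable_norm_det_diracMatrix (S := L) mq
    simp_rw [norm_det_diracMatrix] at this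
    exact this.ennreal_ofReal
  have hW : Integrable φ (qcdLatticeWeight L β mq) := by
    rw [qcdLatticeWeight, integrable_withDensity_iff_integrable_smul' hdens
      (Eventually.of_forall fun _ => ENNReal.ofReal_lt_top)]
    refine Integrable.of_bound (C := C) ?_ (Eventually.of_forall fun U => ?_)
    · exact ((hdens.ennreal_toReal).smul hφ).aestronglyMeasurable
    · have h0 : 0 ≤ ∏ f, ‖fermionDet (wilsonDirac (fundamentalRep (Fin 3)) U (mq f) 1)‖ :=
        Finset.prod_nonneg fun f _ => norm_nonneg _
      rw [ENNReal.toReal_ofReal h0, ← norm_det_diracMatrix, smul_eq_mul, norm_mul, Real.norm_eq_abs,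
        abs_of_nonneg (norm_nonneg _)]
      exact hC U
  have huniv : qcdLatticeWeight L β mq Set.univ ≠ 0 := by
    rw [qcdLatticeWeight_univ]
    exact mul_ne_zero hZ0 (ENNReal.ofReal_pos.2 (integral_norm_det_diracMatrix_pos_all β mq)).ne'
  rw [qcdLatticeMeasure]
  exact hW.smul_measure (ENNReal.inv_ne_top.2 huniv)

/-- Flattening the colour–spin double pair sum into one sum over the `144`-element product type. [folklore] -/
theorem sum_four_eq_sum_prod (g : Fin 3 → Fin 4 → Fin 3 → Fin 4 → ℝ) :
    ∑ a : Fin 3, ∑ i : Fin 4, ∑ b : Fin 3, ∑ j : Fin 4, g a i b j =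
      ∑ x : Fin 3 × Fin 4 × Fin 3 × Fin 4, g x.1 x.2.1 x.2.2.1 x.2.2.2 := by
  symm
  simp only [Fintype.sum_prod_type]

/-- **Cauchy–Schwarz over the `144` colour–spin pairs**: `(Σ|G|)² ≤ 144 · Σ|G|²`. [folklore] -/
theorem sq_sum_four_le (g : Fin 3 → Fin 4 → Fin 3 → Fin 4 → ℝ) :
    (∑ a : Fin 3, ∑ i : Fin 4, ∑ b : Fin 3, ∑ j : Fin 4, g a i b j) ^ 2 ≤
      144 * ∑ a : Fin 3, ∑ i : Fin 4, ∑ b : Fin 3, ∑ j : Fin 4, g a i b j ^ 2 := by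
  rw [sum_four_eq_sum_prod g, sum_four_eq_sum_prod fun a i b j => g a i b j ^ 2]
  have h := sq_sum_le_card_mul_sum_sq (s := (Finset.univ : Finset (Fin 3 × Fin 4 × Fin 3 × Fin 4)))
    (f := fun x => g x.1 x.2.1 x.2.2.1 x.2.2.2)
  have hcard : ((Finset.univ : Finset (Fin 3 × Fin 4 × Fin 3 × Fin 4)).card : ℝ) = 144 := by
    simp [Finset.card_univ, Fintype.card_prod, Fintype.card_fin]
  rw [hcard] at h
  exact h

/-- For `u ≥ 0` and `0 < s ≤ 2`: `u^s ≤ 1 + u²`. [folklore] -/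
theorem rpow_le_one_add_sq {u s : ℝ} (hu : 0 ≤ u) (hs : 0 < s) (hs2 : s ≤ 2) : u ^ s ≤ 1 + u ^ 2 := by
  have h2 : 0 ≤ u ^ 2 := by positivity
  by_cases h1 : u ≤ 1
  · have : u ^ s ≤ 1 := Real.rpow_le_one hu h1 hs.le
    linarith
  · have h1' : 1 ≤ u := le_of_lt (not_le.mp h1)
    have : u ^ s ≤ u ^ (2 : ℝ) := Real.rpow_le_rpow_of_exponent_le h1' hs2
    rw [Real.rpow_two] at this
    linarith

/-- **Jensen bridge at `N_f = 2`: fractional-moment pin ⇒ second-moment (unsigned) pin.** See the module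
docstring: `E₊[Σ|G|²] ≥ (E₊[X^s])^{2/s}/144`, so a frequently-violated certificate for `E₊[X^s]` at rate
`sε/2` with constant `(144·max(C,1))^{s/2}` is one for `E₊[Σ|G|²]` at rate `ε` with constant `C`. -/
theorem unsignedPin_two_of_fmPin :
    ∀ (reg : QCDRegularisation 2) (f : Fin 2) (s : ℝ), 0 < s → s ≤ 2 → (∀ ε : ℝ, 0 < ε → ∃ m : ℝ, 0 < m ∧ ∀ C : ℝ, ∃ᶠ k in atTop, ∃ S : ℕ, reg.L k ≤ S ∧ ∃ n : ℕ, n ≤ S ∧ C * Real.exp (-(ε * (reg.a k * n))) < (∫ U : GaugeConfig 4 (2 * S + 1) (Matrix.specialUnitaryGroup (Fin 3) ℂ), ‖(diracMatrix U fun _ : Fin 2 => reg.mcrit k + reg.a k * m / reg.Zm k).det‖ * (∑ a : Fin 3, ∑ i : Fin 4, ∑ b : Fin 3, ∑ j : Fin 4, ‖(diracMatrix U fun _ : Fin 2 => reg.mcrit k + reg.a k * m / reg.Zm k)⁻¹ (quarkEquiv (f, (Torus.proj (2 * S + 1) 0, a, i))) (quarkEquiv (f, (Torus.proj (2 * S +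 1) (Pi.single 0 (n : ℤ)), b, j)))‖) ^ s ∂(wilsonMeasure (fundamentalRep (Fin 3)) (reg.β k))) / (∫ U : GaugeConfig 4 (2 * S + 1) (Matrix.specialUnitaryGroup (Fin 3) ℂ), ‖(diracMatrix U fun _ : Fin 2 => reg.mcrit k + reg.a k * m / reg.Zm k).det‖ ∂(wilsonMeasure (fundamentalRep (Fin 3)) (reg.β k)))) → ∀ ε : ℝ, 0 < ε → ∃ m : ℝ, 0 < m ∧ ∀ C : ℝ, ∃ᶠ k in atTop, ∃ S : ℕ, reg.L k ≤ S ∧ ∃ n : ℕ, n ≤ S ∧ C * Real.exp (-(ε * (reg.a k * n))) < (∫ U : GaugeConfig 4 (2 * S + 1) (Matrix.specialUnitaryGroup (Fin 3) ℂ), ‖(diracMatrix U fun _ : Fin 2 => reg.mcrit k + reg.a k * m / reg.Zm k).det‖ * (∑ a : Fin 3, ∑ i : Fin 4, ∑ b : Fin 3, ∑ j : Fin 4, ‖(diracMatrix U fun _ : Fin 2 => reg.mcrit k + reg.a k * m / reg.Zm k)⁻¹ (quarkEquiv (f, (Torus.proj (2 * S + 1) 0, a, i))) (quarkEquiv (f,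 (Torus.proj (2 * S + 1) (Pi.single 0 (n : ℤ)), b, j)))‖ ^ (2 : ℕ)) ∂(wilsonMeasure (fundamentalRep (Fin 3)) (reg.β k))) / (∫ U : GaugeConfig 4 (2 * S + 1) (Matrix.specialUnitaryGroup (Fin 3) ℂ), ‖(diracMatrix U fun _ : Fin 2 => reg.mcrit k + reg.a k * m / reg.Zm k).det‖ ∂(wilsonMeasure (fundamentalRep (Fin 3)) (reg.β k))) := by
  intro reg f s hs hs2 h ε hε
  obtain ⟨m, hm, hC⟩ := h (s * ε / 2) (by positivity)
  refine ⟨m, hm, fun C => ?_⟩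
  set Cp : ℝ := max C 1 with hCp
  have hCp0 : 0 < Cp := lt_of_lt_of_le one_pos (le_max_right _ _)
  refine (hC ((144 * Cp) ^ (s / 2))).mono fun k hk => ?_
  obtain ⟨S, hS, n, hn, hlt⟩ := hk
  refine ⟨S, hS, n, hn, ?_⟩
  -- abbreviations at the fixed `k, S, n`
  set t : ℝ := reg.mcrit k + reg.a k * m / reg.Zm k with ht
  set mq : Fin 2 → ℝ := fun _ => t with hmq
  set β : ℝ := reg.β k with hβ
  set μ := wilsonMeasure (d := 4) (L := 2 * S + 1) (fundamentalRep (Fin 3)) β with hμ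
  haveI : IsProbabilityMeasure μ := isProbabilityMeasure_wilsonMeasure _ (continuous_fundamentalRep _) _
  set P : Fin 3 → Fin 4 → FermiIdx 2 (2 * S + 1) := fun a i => quarkEquiv (f, (Torus.proj (2 * S + 1) 0, a, i))
    with hP
  set Q : Fin 3 → Fin 4 → FermiIdx 2 (2 * S + 1) := fun b j =>
    quarkEquiv (f, (Torus.proj (2 * S + 1) (Pi.single 0 (n : ℤ)), b, j)) with hQ
  set G : GaugeConfig 4 (2 * S + 1) SU3 → Fin 3 → Fin 4 → Fin 3 → Fin 4 → ℝ :=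
    fun U a i b j => ‖(diracMatrix U mq)⁻¹ (P a i) (Q b j)‖ with hG
  set Y : GaugeConfig 4 (2 * S + 1) SU3 → ℝ := fun U =>
    ∑ a : Fin 3, ∑ i : Fin 4, ∑ b : Fin 3, ∑ j : Fin 4, G U a i b j with hY
  set Y2 : GaugeConfig 4 (2 * S + 1) SU3 → ℝ := fun U =>
    ∑ a : Fin 3, ∑ i : Fin 4, ∑ b : Fin 3, ∑ j : Fin 4, G U a i b j ^ 2 with hY2
  have hG0 : ∀ U a i b j, 0 ≤ G U a i b j := fun U a i b j => norm_nonneg _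
  have hY0 : ∀ U, 0 ≤ Y U := fun U => Finset.sum_nonneg fun a _ => Finset.sum_nonneg fun i _ =>
    Finset.sum_nonneg fun b _ => Finset.sum_nonneg fun j _ => hG0 U a i b j
  have hY20 : ∀ U, 0 ≤ Y2 U := fun U => Finset.sum_nonneg fun a _ => Finset.sum_nonneg fun i _ =>
    Finset.sum_nonneg fun b _ => Finset.sum_nonneg fun j _ => sq_nonneg _
  -- measurability
  have hGm : ∀ a i b j, Measurable fun U => G U a i b j := fun a i b j =>
    (measurable_inv_diracMatrix_apply mq (P a i) (Q b j)).norm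
  have hYm : Measurable Y := Finset.measurable_sum _ fun a _ => Finset.measurable_sum _ fun i _ =>
    Finset.measurable_sum _ fun b _ => Finset.measurable_sum _ fun j _ => hGm a i b j
  have hY2m : Measurable Y2 := Finset.measurable_sum _ fun a _ => Finset.measurable_sum _ fun i _ =>
    Finset.measurable_sum _ fun b _ => Finset.measurable_sum _ fun j _ => (hGm a i b j).pow_const 2
  -- the uniform weight bound `|det D| · G² ≤ B`
  have hc : Continuous fun U : GaugeConfig 4 (2 * S + 1) SU3 => wilsonDirac (fundamentalRep (Fin 3)) U t 1 :=
    continuous_wilsonDirac _ (continuous_fundamentalRep (Fin 3)) t 1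
  obtain ⟨B, hB⟩ : ∃ B : ℝ, ∀ (U : GaugeConfig 4 (2 * S + 1) SU3) a i b j,
      ‖(diracMatrix U mq).det‖ * G U a i b j ^ 2 ≤ B := by
    have hcont : Continuous fun U : GaugeConfig 4 (2 * S + 1) SU3 =>
        ∑ a : Fin 3, ∑ i : Fin 4, ∑ b : Fin 3, ∑ j : Fin 4,
          ‖(wilsonDirac (fundamentalRep (Fin 3)) U t 1).adjugate (Torus.proj (2 * S + 1) 0, a, i)
            (Torus.proj (2 * S + 1) (Pi.single 0 (n : ℤ)), b, j)‖ ^ 2 := by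
      refine continuous_finsetSum _ fun a _ => continuous_finsetSum _ fun i _ =>
        continuous_finsetSum _ fun b _ => continuous_finsetSum _ fun j _ => ?_
      exact ((hc.matrix_adjugate.matrix_elem _ _).norm).pow 2
    obtain ⟨U₀, -, hU₀⟩ := (isCompact_univ (X := GaugeConfig 4 (2 * S + 1) SU3)).exists_isMaxOn
      Set.univ_nonempty hcont.continuousOn
    refine ⟨∑ a : Fin 3, ∑ i : Fin 4, ∑ b : Fin 3, ∑ j : Fin 4,
          ‖(wilsonDirac (fundamentalRep (Fin 3)) U₀ t 1).adjugate (Torus.proj (2 * S + 1) 0, a, i)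
            (Torus.proj (2 * S + 1) (Pi.single 0 (n : ℤ)), b, j)‖ ^ 2, fun U a i b j => ?_⟩
    refine (norm_det_mul_normSq_inv_le_two U t f _ _).trans ((?_ : _ ≤ _).trans (hU₀ (Set.mem_univ U)))
    -- one term is bounded by the full (non-negative) sum
    have h1 : ∀ a' i' b' j', 0 ≤ ‖(wilsonDirac (fundamentalRep (Fin 3)) U t 1).adjugate
        (Torus.proj (2 * S + 1) 0, a', i') (Torus.proj (2 * S + 1) (Pi.single 0 (n : ℤ)), b', j')‖ ^ 2 :=
      fun _ _ _ _ => sq_nonneg _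
    calc ‖(wilsonDirac (fundamentalRep (Fin 3)) U t 1).adjugate (Torus.proj (2 * S + 1) 0, a, i)
            (Torus.proj (2 * S + 1) (Pi.single 0 (n : ℤ)), b, j)‖ ^ 2
        ≤ ∑ j' : Fin 4, ‖(wilsonDirac (fundamentalRep (Fin 3)) U t 1).adjugate (Torus.proj (2 * S + 1) 0, a, i)
            (Torus.proj (2 * S + 1) (Pi.single 0 (n : ℤ)), b, j')‖ ^ 2 :=
          Finset.single_le_sum (fun j' _ => h1 a i b j') (Finset.mem_univ j)
      _ ≤ ∑ b' : Fin 3, ∑ j' : Fin 4, ‖(wilsonDirac (fundamentalRep (Fin 3)) U t 1).adjugate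
            (Torus.proj (2 * S + 1) 0, a, i) (Torus.proj (2 * S + 1) (Pi.single 0 (n : ℤ)), b', j')‖ ^ 2 :=
          Finset.single_le_sum (fun b' _ => Finset.sum_nonneg fun j' _ => h1 a i b' j') (Finset.mem_univ b)
      _ ≤ ∑ i' : Fin 4, ∑ b' : Fin 3, ∑ j' : Fin 4, ‖(wilsonDirac (fundamentalRep (Fin 3)) U t 1).adjugate
            (Torus.proj (2 * S + 1) 0, a, i') (Torus.proj (2 * S + 1) (Pi.single 0 (n : ℤ)), b', j')‖ ^ 2 :=
          Finset.single_le_sum (fun i' _ => Finset.sum_nonneg fun b' _ => Finset.sum_nonneg fun j' _ =>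
            h1 a i' b' j') (Finset.mem_univ i)
      _ ≤ ∑ a' : Fin 3, ∑ i' : Fin 4, ∑ b' : Fin 3, ∑ j' : Fin 4,
            ‖(wilsonDirac (fundamentalRep (Fin 3)) U t 1).adjugate (Torus.proj (2 * S + 1) 0, a', i')
              (Torus.proj (2 * S + 1) (Pi.single 0 (n : ℤ)), b', j')‖ ^ 2 :=
          Finset.single_le_sum (fun a' _ => Finset.sum_nonneg fun i' _ => Finset.sum_nonneg fun b' _ =>
            Finset.sum_nonneg fun j' _ => h1 a' i' b' j') (Finset.mem_univ a)
  have hB0 : 0 ≤ B := le_trans (by positivity) (hB (TwistedFreeWilson.twistCfg _) 0 0 0 0)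
  -- weight bounds for `Y2`, `Y ^ 2` and `Y ^ s`
  have hwY2 : ∀ U, ‖(diracMatrix U mq).det‖ * Y2 U ≤ 144 * B := by
    intro U
    have : ‖(diracMatrix U mq).det‖ * Y2 U =
        ∑ a : Fin 3, ∑ i : Fin 4, ∑ b : Fin 3, ∑ j : Fin 4, ‖(diracMatrix U mq).det‖ * G U a i b j ^ 2 := by
      simp only [hY2, Finset.mul_sum]
    rw [this]
    calc ∑ a : Fin 3, ∑ i : Fin 4, ∑ b : Fin 3, ∑ j : Fin 4, ‖(diracMatrix U mq).det‖ * G U a i b j ^ 2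
        ≤ ∑ _a : Fin 3, ∑ _i : Fin 4, ∑ _b : Fin 3, ∑ _j : Fin 4, B :=
          Finset.sum_le_sum fun a _ => Finset.sum_le_sum fun i _ => Finset.sum_le_sum fun b _ =>
            Finset.sum_le_sum fun j _ => hB U a i b j
      _ = 144 * B := by simp; ring
  have hYsq : ∀ U, Y U ^ 2 ≤ 144 * Y2 U := fun U => sq_sum_four_le (G U)
  have hwYsq : ∀ U, ‖(diracMatrix U mq).det‖ * Y U ^ 2 ≤ 144 * (144 * B) := fun U =>
    calc ‖(diracMatrix U mq).det‖ * Y U ^ 2 ≤ ‖(diracMatrix U mq).det‖ * (144 * Y2 U) :=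
          mul_le_mul_of_nonneg_left (hYsq U) (norm_nonneg _)
      _ = 144 * (‖(diracMatrix U mq).det‖ * Y2 U) := by ring
      _ ≤ 144 * (144 * B) := by nlinarith [hwY2 U]
  obtain ⟨Bd, hBd⟩ := exists_norm_det_diracMatrix_le (S := 2 * S + 1) mq
  have hwYs : ∀ U, ‖(diracMatrix U mq).det‖ * Y U ^ s ≤ Bd + 144 * (144 * B) := fun U =>
    calc ‖(diracMatrix U mq).det‖ * Y U ^ s ≤ ‖(diracMatrix U mq).det‖ * (1 + Y U ^ 2) :=
          mul_le_mul_of_nonneg_left (rpow_le_one_add_sq (hY0 U) hs hs2) (norm_nonneg _)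
      _ = ‖(diracMatrix U mq).det‖ + ‖(diracMatrix U mq).det‖ * Y U ^ 2 := by ring
      _ ≤ Bd + 144 * (144 * B) := add_le_add (hBd U) (hwYsq U)
  -- integrability under the phase-quenched probability measure (for Jensen)
  have hiYs : Integrable (fun U => Y U ^ s) (qcdLatticeMeasure (2 * S + 1) β mq) :=
    integrable_qcdLatticeMeasure_of_weight_bound β mq _ (hYm.pow_const s) _ fun U => by
      rw [Real.norm_eq_abs, abs_of_nonneg (Real.rpow_nonneg (hY0 U) s)]; exact hwYs U
  have hiY2r : Integrable (fun U => Y U ^ (2 : ℝ)) (qcdLatticeMeasure (2 * S + 1) β mq) := by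
    simp_rw [Real.rpow_two]
    exact integrable_qcdLatticeMeasure_of_weight_bound β mq _ (hYm.pow_const 2) _ fun U => by
      rw [Real.norm_eq_abs, abs_of_nonneg (sq_nonneg _)]; exact hwYsq U
  -- integrability against the Wilson measure with the weight (for monotonicity)
  have hdm := measurable_norm_det_diracMatrix (S := 2 * S + 1) mq
  have hiwYsq : Integrable (fun U => ‖(diracMatrix U mq).det‖ * Y U ^ (2 : ℝ)) μ := by
    simp_rw [Real.rpow_two]
    refine Integrable.of_bound (hdm.mul (hYm.pow_const 2)).aestronglyMeasurable (144 * (144 * B))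
      (Eventually.of_forall fun U => ?_)
    rw [Real.norm_eq_abs, abs_of_nonneg (mul_nonneg (norm_nonneg _) (sq_nonneg _))]
    exact hwYsq U
  have hiwY2 : Integrable (fun U => ‖(diracMatrix U mq).det‖ * (144 * Y2 U)) μ := by
    refine Integrable.of_bound (hdm.mul (hY2m.const_mul 144)).aestronglyMeasurable (144 * (144 * B))
      (Eventually.of_forall fun U => ?_)
    rw [Real.norm_eq_abs, abs_of_nonneg (mul_nonneg (norm_nonneg _) (by nlinarith [hY20 U]))]
    calc ‖(diracMatrix U mq).det‖ * (144 * Y2 U) = 144 * (‖(diracMatrix U mq).det‖ * Y2 U) := by ring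
      _ ≤ 144 * (144 * B) := by nlinarith [hwY2 U]
  -- Jensen and Cauchy–Schwarz in phase-quenched form
  have hZ := integral_norm_det_diracMatrix_pos_all (S := 2 * S + 1) β mq
  have hJ : qcdPhaseQuenchedExpect β (2 * S + 1) mq (fun U => Y U ^ s) ≤
      (qcdPhaseQuenchedExpect β (2 * S + 1) mq (fun U => Y U ^ (2 : ℝ))) ^ (s / 2) :=
    qcdPhaseQuenchedExpect_rpow_le_rpow β mq hZ Y hY0 hs hs2 hiYs hiY2r
  have hCS : qcdPhaseQuenchedExpect β (2 * S + 1) mq (fun U => Y U ^ (2 : ℝ)) ≤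
      qcdPhaseQuenchedExpect β (2 * S + 1) mq (fun U => 144 * Y2 U) :=
    qcdPhaseQuenchedExpect_mono β mq _ _ hiwYsq hiwY2 (Eventually.of_forall fun U => by
      rw [Real.rpow_two]; exact hYsq U)
  have hlin : qcdPhaseQuenchedExpect β (2 * S + 1) mq (fun U => 144 * Y2 U) =
      144 * qcdPhaseQuenchedExpect β (2 * S + 1) mq Y2 := by
    have := qcdPhaseQuenchedExpect_smul β mq (144 : ℝ) Y2
    simp only [smul_eq_mul] at this
    exact this
  have hq2 : 0 ≤ qcdPhaseQuenchedExpect β (2 * S + 1) mq (fun U => Y U ^ (2 : ℝ)) := by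
    rw [qcdPhaseQuenchedExpect_eq_div]
    exact div_nonneg (integral_nonneg fun U => mul_nonneg (norm_nonneg _) (Real.rpow_nonneg (hY0 U) _))
      (integral_nonneg fun U => norm_nonneg _)
  -- the fractional-moment quotient of the hypothesis IS `⟨Y^s⟩₊`, the target quotient IS `⟨Y2⟩₊`
  have hFM : (∫ U, ‖(diracMatrix U mq).det‖ * Y U ^ s ∂μ) / (∫ U, ‖(diracMatrix U mq).det‖ ∂μ) =
      qcdPhaseQuenchedExpect β (2 * S + 1) mq (fun U => Y U ^ s) :=
    (qcdPhaseQuenchedExpect_eq_div β mq _).symm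
  have hQ2 : (∫ U, ‖(diracMatrix U mq).det‖ * Y2 U ∂μ) / (∫ U, ‖(diracMatrix U mq).det‖ ∂μ) =
      qcdPhaseQuenchedExpect β (2 * S + 1) mq Y2 :=
    (qcdPhaseQuenchedExpect_eq_div β mq _).symm
  -- bookkeeping of the constants
  change C * Real.exp (-(ε * (reg.a k * n))) <
    (∫ U, ‖(diracMatrix U mq).det‖ * Y2 U ∂μ) / (∫ U, ‖(diracMatrix U mq).det‖ ∂μ)
  change (144 * Cp) ^ (s / 2) * Real.exp (-(s * ε / 2 * (reg.a k * n))) <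
    (∫ U, ‖(diracMatrix U mq).det‖ * Y U ^ s ∂μ) / (∫ U, ‖(diracMatrix U mq).det‖ ∂μ) at hlt
  rw [hQ2]
  rw [hFM] at hlt
  have hexp : Real.exp (-(s * ε / 2 * (reg.a k * n))) = Real.exp (-(ε * (reg.a k * n))) ^ (s / 2) := by
    rw [← Real.exp_mul]; congr 1; ring
  have hbase : 0 ≤ 144 * Cp * Real.exp (-(ε * (reg.a k * n))) := by positivity
  have hlhs : (144 * Cp) ^ (s / 2) * Real.exp (-(s * ε / 2 * (reg.a k * n))) =
      (144 * Cp * Real.exp (-(ε * (reg.a k * n)))) ^ (s / 2) := by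
    rw [hexp, Real.mul_rpow (by positivity) (Real.exp_pos _).le]
  rw [hlhs] at hlt
  have h1 : (144 * Cp * Real.exp (-(ε * (reg.a k * n)))) ^ (s / 2) <
      (qcdPhaseQuenchedExpect β (2 * S + 1) mq (fun U => Y U ^ (2 : ℝ))) ^ (s / 2) :=
    hlt.trans_le hJ
  have h2 : 144 * Cp * Real.exp (-(ε * (reg.a k * n))) <
      qcdPhaseQuenchedExpect β (2 * S + 1) mq (fun U => Y U ^ (2 : ℝ)) :=
    (Real.rpow_lt_rpow_iff hbase hq2 (by positivity)).1 h1
  have h3 : 144 * Cp * Real.exp (-(ε * (reg.a k * n))) < 144 * qcdPhaseQuenchedExpect β (2 * S + 1) mq Y2 :=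
    h2.trans_le (hCS.trans_eq hlin)
  have h4 : Cp * Real.exp (-(ε * (reg.a k * n))) < qcdPhaseQuenchedExpect β (2 * S + 1) mq Y2 := by
    nlinarith [h3]
  calc C * Real.exp (-(ε * (reg.a k * n))) ≤ Cp * Real.exp (-(ε * (reg.a k * n))) :=
        mul_le_mul_of_nonneg_right (le_max_left _ _) (Real.exp_pos _).le
    _ < qcdPhaseQuenchedExpect β (2 * S + 1) mq Y2 := h4

end Summit.QuantumFields.QCD.Cruxes.ChiralOneScaleTrajectory.GoldstoneWitness

end
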